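import Mathlib.Analysis.SpecialFunctions.SmoothTransition
import Mathlib.Analysis.Calculus.Deriv.MeanValue
import Mathlib.Analysis.Calculus.Deriv.Slope
import Mathlib.Analysis.Calculus.LocalExtr.Basic
import Mathlib.Analysis.InnerProductSpace.Calculus
import Mathlib.Topology.OpenPartialHomeomorph.Basic
import Literature.Topology.FourManifolds.RadialDiffeomorph
import Literature.Topology.FourManifolds.PalaisBallComplement
import Literature.Topology.FourManifolds.ConnectedSum
import Literature.Topology.FourManifolds.ConnectedSumData
import Literature.Topology.FourManifolds.ConnectedSumTransportProofs
import Literature.Topology.FourManifolds.CerfGammaFourProofs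
import HarnessLib

/-!
# The sphere as an open gluing of two punctured spheres (`Sⁿ = Sⁿ # Sⁿ` for the standard discs)

Topic `Literature/Topology/FourManifolds` (trunk T-4MAN), companion to
`Literature.Topology.FourManifolds.ConnectedSum` (`Literature.Topology.FourManifolds.IsOpenGluing`, `Literature.Topology.FourManifolds.IsConnectedSum`,
Kervaire–Milnor's relational connected sum) and input of the discharge of the named fact
`Literature.Topology.FourManifolds.connectedSum_sphere_sphere` (`ConnectedSumSpheres.lean`; Kervaire–Milnor, *Groups of
homotopy spheres I*, Ann. of Math. 77 (1963), §2, Lemma 2.1: the connected sum is well defined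
and `Sⁿ` is its identity element, whence `Sⁿ # Sⁿ ≅ Sⁿ`). The reviewer of that fact recorded
what was missing for a discharge: *the construction of `Sⁿ` as an open gluing of the two
punctured pieces*. This file supplies it, for every `n` and every real inner product space `V`
of dimension `n + 1` with unit sphere `S`:

* `Literature.SphereGluing.isOpenGluing_sphere v L` — for a pole `v ∈ S` and a linear isometry `L` of
  `ℝⁿ`, the sphere `S` is an open gluing (`Literature.Topology.FourManifolds.IsOpenGluing`) of `S ∖ {-v}` and `S ∖ {-v}` along
  Kervaire–Milnor's relation `connectedSumRel σᵥ⁻¹ (σᵥ⁻¹ ∘ L)` of the standard disc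
  `σᵥ⁻¹ = (stereographic' n v).symm` (centred at `σᵥ⁻¹ 0 = -v`) and its precomposition with
  `L`. The isometry `L ∈ O(n)` is carried along because Palais' disc theorem standardises a disc
  only up to such an isometry (`Literature.Topology.FourManifolds.exists_diffeomorph_apply_stereographic_symm_eq`,
  `PalaisDiscSphere.lean`).
* `Literature.Topology.FourManifolds.SphereGluing.isConnectedSum_sphere_sphere_self` — consequently `S` is a connected sum
  `S # S` (`Literature.Topology.FourManifolds.IsConnectedSum`).

## Construction

Write `R` for the reflection of `S` in `vᗮ` (`Literature.Topology.FourManifolds.poleReflectionSphere`, exchanging `±v`; on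
the chart, `R(σᵥ⁻¹ z) = σᵥ⁻¹(4z/‖z‖²)`, `Literature.Topology.FourManifolds.poleReflection_stereographic'_symm` of
`PalaisBallComplement.lean`). On the piece `S ∖ {-v}` use the coordinate `X = σᵥ(R a)/4 ∈ ℝⁿ`
(so `a = σᵥ⁻¹(t u)`, `‖u‖ = 1`, reads `X = u/t`); in these coordinates on both pieces the
relation `σᵥ⁻¹(t u) ∼ σᵥ⁻¹(L((1 - t) u))`, `0 < t < 1`, reads `1 < ‖X‖ ∧ Y = X/(‖X‖ - 1)`
(after absorbing `L`), i.e. "same direction, and the radii `s = ‖X‖ > 1`, `‖Y‖ = s/(s-1)` are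
exchanged by the involution `ι(s) = s/(s-1)` of `(1, ∞)`". The gluing embeddings are
`jA(a) = R(σᵥ⁻¹(B X))`, `jB(b) = σᵥ⁻¹(B Y)` for the **radial diffeomorphism**
`B = Literature.radialMap p : X ↦ (p(‖X‖)/‖X‖) X` of `ℝⁿ` onto the ball of radius `P = 10/3` (the
radial-map toolkit `Literature.Topology.FourManifolds.radialMap`, `Literature.Topology.FourManifolds.contDiffAt_radialMap`, `Literature.Topology.FourManifolds.radialMap_radialMap`, … of
`RadialDiffeomorph.lean` is reused; only the profile `p` is specific to this file), whose
profile `p` satisfies the functional equation `p(s) · p(ι(s)) = 4` on `(1, ∞)` (Mathlib's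
normalisation of `stereographic'` makes the equator the sphere of radius `2`): then
`jA a = jB b ⇔ B Y = 4 B X/‖B X‖² ⇔ 1 < ‖X‖ ∧ Y = X/(‖X‖ - 1)` (`radial_rel_iff`), and the two
ranges, the cap `σᵥ⁻¹(ball 0 P) = {⟪y, v⟫ < 8/17}` and its reflection, cover `S` because `P > 2`.

The profile: `p = id` on `[0, 2/3]`, `p = p_out` on `[1, ∞)` with the Möbius function
`p_out(s) = 2(5s - 2)/(3s + 2)` — which satisfies `p_out(s) p_out(s/(s-1)) = 4` identically,
increases, and tends to `10/3` — spliced on `[2/3, 1]` by Mathlib's `Real.smoothTransition`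
(`p = id + χ · (p_out - id)`, monotone because `p_out ≥ id` on `[2/3, 2]`). A splice is
unavoidable: no profile real-analytic at `0` can satisfy the functional equation (its germ at `0`
would have to be odd, while the equation forces `p(s) → 4/p(1) ≠ 0` along the continuation), so
the inverse profile `q` is not elementary on the splice zone and its smoothness is obtained from
the inverse function theorem (`Literature.Topology.FourManifolds.contDiffAt_leftInverse_of_hasDerivAt`, `p' > 0`). Since
`p = id` near `0`, `B = id` near the origin (`Literature.Topology.FourManifolds.radialMap_eq_smul_of_norm_lt`) and no
polar-coordinate singularity has to be analysed. Everything is elementary real analysis plus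
Mathlib's manifold API; the smooth-embedding property of the gluing maps comes from
`Manifold.IsSmoothEmbedding.of_opens` composed with the model diffeomorphisms
`Θ_T : S ∖ {-v} ≅ cap` (`modelDiffeo`; the factor `1/4` of the coordinate `X` is built into
`modelFun`).

## Main declarations

* `Literature.Topology.FourManifolds.SphereGluing.profile`, `profileInv`: the profile `p` and its inverse `q`; the radial
  diffeomorphism is `Literature.radialMap profile` with inverse `Literature.radialMap profileInv` on the ball
  of radius `10/3` (`radialMap_profileInv_radialMap_profile`,
  `radialMap_profile_radialMap_profileInv`, `contDiff_radialMap_profile`,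
  `contDiffOn_radialMap_profileInv`).
* `Literature.Topology.FourManifolds.SphereGluing.radial_rel_iff`: the gluing relation in radial coordinates.
* `Literature.Topology.FourManifolds.SphereGluing.cap`, `modelDiffeo`: the cap `{⟪y, v⟫ < 8/17}` and `Θ_T : S ∖ {-v} ≅ cap`.
* `Literature.Topology.FourManifolds.SphereGluing.isOpenGluing_sphere`, `Literature.Topology.FourManifolds.SphereGluing.isConnectedSum_sphere_sphere_self`:
  the model gluing.

## References

* M. Kervaire, J. Milnor, *Groups of homotopy spheres I*, Ann. of Math. 77 (1963) 504–537, §2,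
  Lemma 2.1 (p. 505) and the definition of `M₁ # M₂` preceding it. [KervaireMilnor1963]
* A. Kosinski, *Differential Manifolds* (1993), Ch. VI §1 (gluing along open subsets; (1.3):
  `M # Sⁿ = M`). [Kosinski1993]
-/

open scoped Topology ContDiff Manifold RealInnerProductSpace
open Set Function Filter Module

noncomputable section

namespace Literature.Topology.FourManifolds.SphereGluing

/-- The cut-off `χ(s) = smoothTransition (3s - 2)`: `0` for `s ≤ 2/3`, `1` for `1 ≤ s`.
[folklore] -/
def cutoff (s : ℝ) : ℝ := Real.smoothTransition (3 * s - 2)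

/-- The cut-off vanishes for `s ≤ 2/3`. [folklore] -/
theorem cutoff_of_le {s : ℝ} (hs : s ≤ 2 / 3) : cutoff s = 0 :=
  Real.smoothTransition.zero_of_nonpos (by linarith)

/-- The cut-off equals `1` for `1 ≤ s`. [folklore] -/
theorem cutoff_of_one_le {s : ℝ} (hs : 1 ≤ s) : cutoff s = 1 :=
  Real.smoothTransition.one_of_one_le (by linarith)

/-- The cut-off is nonnegative. [folklore] -/
theorem cutoff_nonneg (s : ℝ) : 0 ≤ cutoff s := Real.smoothTransition.nonneg _

/-- The cut-off is at most `1`. [folklore] -/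
theorem cutoff_le_one (s : ℝ) : cutoff s ≤ 1 := Real.smoothTransition.le_one _

/-- The cut-off is smooth. [folklore] -/
theorem contDiff_cutoff : ContDiff ℝ ∞ cutoff :=
  Real.smoothTransition.contDiff.comp ((contDiff_const.mul contDiff_id).sub contDiff_const)

/-- The cut-off is monotone. [folklore] -/
theorem monotone_cutoff : Monotone cutoff := fun _ _ h =>
  Real.smoothTransition.monotone (by linarith)

/-- The derivative of the cut-off is nonnegative. [folklore] -/
theorem deriv_cutoff_nonneg (s : ℝ) : 0 ≤ deriv cutoff s := monotone_cutoff.deriv_nonneg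

/-- The cut-off is differentiable. [folklore] -/
theorem hasDerivAt_cutoff (s : ℝ) : HasDerivAt cutoff (deriv cutoff s) s :=
  (contDiff_cutoff.differentiable (by simp) s).hasDerivAt

/-- For `1 < s` the cut-off is locally constant, so its derivative vanishes. [folklore] -/
theorem deriv_cutoff_of_one_lt {s : ℝ} (hs : 1 < s) : deriv cutoff s = 0 := by
  have h : cutoff =ᶠ[𝓝 s] fun _ => (1 : ℝ) :=
    (eventually_gt_nhds hs).mono fun _ ht => cutoff_of_one_le ht.le
  rw [h.deriv_eq]; simp

/-- The outer (Möbius) profile `p_out(s) = 2(5s - 2)/(3s + 2)`. [folklore] -/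
def outerProfile (s : ℝ) : ℝ := 2 * (5 * s - 2) / (3 * s + 2)

/-- Partial-fraction form of the outer profile: `p_out(s) = 10/3 - (32/3)/(3s+2)`. [folklore] -/
theorem outerProfile_eq {s : ℝ} (hs : 3 * s + 2 ≠ 0) :
    outerProfile s = 10 / 3 - 32 / 3 / (3 * s + 2) := by
  have hs' : s * 3 + 2 ≠ 0 := by intro h; apply hs; linarith
  unfold outerProfile
  field_simp
  ring

/-- The functional equation `p_out(s) · p_out(s/(s-1)) = 4` for `1 < s`. [folklore] -/
theorem outerProfile_mul_outerProfile {s : ℝ} (hs : 1 < s) :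
    outerProfile s * outerProfile (s / (s - 1)) = 4 := by
  have h1 : s - 1 ≠ 0 := by linarith
  have h2 : 3 * s + 2 ≠ 0 := by linarith
  have h3 : 5 * s - 2 ≠ 0 := by linarith
  have h4 : 3 * (s / (s - 1)) + 2 = (5 * s - 2) / (s - 1) := by field_simp; ring
  have h5 : 5 * (s / (s - 1)) - 2 = (3 * s + 2) / (s - 1) := by field_simp; ring
  have h6 : outerProfile (s / (s - 1)) = 2 * (3 * s + 2) / (5 * s - 2) := by
    unfold outerProfile
    rw [h4, h5, ← mul_div_assoc, div_div_div_cancel_right₀ h1]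
  rw [h6, outerProfile, div_mul_div_comm, div_eq_iff (mul_ne_zero h2 h3)]
  ring

/-- `p_out'(s) = 32/(3s+2)²`. [folklore] -/
theorem hasDerivAt_outerProfile {s : ℝ} (hs : 3 * s + 2 ≠ 0) :
    HasDerivAt outerProfile (32 / (3 * s + 2) ^ 2) s := by
  unfold outerProfile
  have hs' : s * 3 + 2 ≠ 0 := by intro h; apply hs; linarith
  have h1 : HasDerivAt (fun s : ℝ => 2 * (5 * s - 2)) (2 * 5) s := by
    simpa using ((hasDerivAt_id s).const_mul 5 |>.sub_const 2).const_mul 2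
  have h2 : HasDerivAt (fun s : ℝ => 3 * s + 2) 3 s := by
    simpa using ((hasDerivAt_id s).const_mul 3).add_const 2
  refine (h1.div h2 hs).congr_deriv ?_
  rw [div_left_inj' (pow_ne_zero 2 hs)]
  ring

/-- The outer profile is smooth away from its pole `s = -2/3`. [folklore] -/
theorem contDiffAt_outerProfile {s : ℝ} (hs : 3 * s + 2 ≠ 0) : ContDiffAt ℝ ∞ outerProfile s := by
  unfold outerProfile
  exact (contDiffAt_const.mul ((contDiffAt_const.mul contDiffAt_id).sub contDiffAt_const)).div
    ((contDiffAt_const.mul contDiffAt_id).add contDiffAt_const) hs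

/-- `p_out(1) = 6/5`. [folklore] -/
theorem outerProfile_one : outerProfile 1 = 6 / 5 := by norm_num [outerProfile]

/-- `p_out < 10/3` on `[0, ∞)`. [folklore] -/
theorem outerProfile_lt (s : ℝ) (hs : 0 ≤ s) : outerProfile s < 10 / 3 := by
  rw [outerProfile, div_lt_iff₀ (by linarith)]
  nlinarith

/-- `s ≤ p_out(s)` on `[2/3, 2]`. [folklore] -/
theorem le_outerProfile {s : ℝ} (h1 : 2 / 3 ≤ s) (h2 : s ≤ 2) : s ≤ outerProfile s := by
  rw [outerProfile, le_div_iff₀ (by linarith)]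
  nlinarith

/-- The outer profile is monotone on `[0, ∞)`. [folklore] -/
theorem outerProfile_mono {s t : ℝ} (hs : 0 ≤ s) (hst : s ≤ t) :
    outerProfile s ≤ outerProfile t := by
  rw [outerProfile, outerProfile, div_le_div_iff₀ (by linarith) (by linarith)]
  nlinarith

/-- The radial profile `p(s) = s + χ(s) (p_out(s) - s)`: the identity for `s ≤ 2/3`, the Möbius
profile `p_out` for `1 ≤ s`. [folklore] -/
def profile (s : ℝ) : ℝ := s + cutoff s * (outerProfile s - s)

/-- The profile is the identity on `(-∞, 2/3]`. [folklore] -/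
theorem profile_of_le {s : ℝ} (hs : s ≤ 2 / 3) : profile s = s := by
  simp [profile, cutoff_of_le hs]

/-- The profile is the outer (Möbius) profile on `[1, ∞)`. [folklore] -/
theorem profile_of_one_le {s : ℝ} (hs : 1 ≤ s) : profile s = outerProfile s := by
  simp [profile, cutoff_of_one_le hs]

/-- `p(0) = 0`. [folklore] -/
theorem profile_zero : profile 0 = 0 := profile_of_le (by norm_num)

/-- Near a point `s < 2/3` the profile is the identity. [folklore] -/
theorem profile_eventuallyEq_id {s : ℝ} (hs : s < 2 / 3) : profile =ᶠ[𝓝 s] id :=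
  (eventually_lt_nhds hs).mono fun _ ht => profile_of_le ht.le

/-- The profile is smooth at every point. [folklore] -/
theorem contDiffAt_profile (s : ℝ) : ContDiffAt ℝ ∞ profile s := by
  by_cases hs : s < 2 / 3
  · exact contDiffAt_id.congr_of_eventuallyEq (profile_eventuallyEq_id hs)
  · have h3 : 3 * s + 2 ≠ 0 := by push Not at hs; linarith
    exact contDiffAt_id.add (contDiff_cutoff.contDiffAt.mul
      ((contDiffAt_outerProfile h3).sub contDiffAt_id))

/-- The profile is smooth. [folklore] -/
theorem contDiff_profile : ContDiff ℝ ∞ profile :=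
  contDiff_iff_contDiffAt.2 contDiffAt_profile

/-- The profile is continuous. [folklore] -/
theorem continuous_profile : Continuous profile := contDiff_profile.continuous

/-- The derivative of the profile (away from the pole of the outer profile). [folklore] -/
theorem hasDerivAt_profile {s : ℝ} (h3 : 3 * s + 2 ≠ 0) :
    HasDerivAt profile
      (1 + (deriv cutoff s * (outerProfile s - s) + cutoff s * (32 / (3 * s + 2) ^ 2 - 1))) s := by
  unfold profile
  exact (hasDerivAt_id s).add ((hasDerivAt_cutoff s).mul
    ((hasDerivAt_outerProfile h3).sub (hasDerivAt_id s)))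

/-- The profile has positive derivative everywhere: on the splice zone `[2/3, 1]` all three terms
`(1-χ)`, `χ p_out'`, `χ' (p_out - id)` are nonnegative and the first two do not vanish together;
beyond `1` the cut-off is locally constant. [folklore] -/
theorem deriv_profile_pos (s : ℝ) : 0 < deriv profile s := by
  by_cases hs : s < 2 / 3
  · rw [(profile_eventuallyEq_id hs).deriv_eq, deriv_id]; exact one_pos
  push Not at hs
  have h3 : 3 * s + 2 ≠ 0 := by linarith
  rw [(hasDerivAt_profile h3).deriv]
  have hc0 := cutoff_nonneg s
  have hc1 := cutoff_le_one s
  have hpos : 0 < 32 / (3 * s + 2) ^ 2 := by positivity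
  by_cases h2 : s ≤ 2
  · have hd := deriv_cutoff_nonneg s
    have hle := le_outerProfile hs h2
    nlinarith [mul_nonneg hd (sub_nonneg.2 hle), mul_nonneg hc0 hpos.le]
  · push Not at h2
    rw [deriv_cutoff_of_one_lt (by linarith)]
    nlinarith [mul_nonneg hc0 hpos.le]

/-- The profile is strictly increasing. [folklore] -/
theorem strictMono_profile : StrictMono profile := strictMono_of_deriv_pos deriv_profile_pos

/-- The profile is injective. [folklore] -/
theorem injective_profile : Injective profile := strictMono_profile.injective

/-- The profile is positive on `(0, ∞)`. [folklore] -/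
theorem profile_pos {s : ℝ} (hs : 0 < s) : 0 < profile s := by
  simpa [profile_zero] using strictMono_profile hs

/-- The profile is nonnegative on `[0, ∞)`. [folklore] -/
theorem profile_nonneg {s : ℝ} (hs : 0 ≤ s) : 0 ≤ profile s := by
  simpa [profile_zero] using strictMono_profile.monotone hs

/-- The profile is bounded by `10/3 = p_out(∞)`. [folklore] -/
theorem profile_lt (s : ℝ) : profile s < 10 / 3 := by
  by_cases hs : s ≤ 2 / 3
  · rw [profile_of_le hs]; linarith
  push Not at hs
  by_cases h1 : 1 ≤ s
  · rw [profile_of_one_le h1]; exact outerProfile_lt s (by linarith)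
  · push Not at h1
    have hc0 := cutoff_nonneg s
    have hc1 := cutoff_le_one s
    have ho : outerProfile s ≤ 6 / 5 := by
      rw [← outerProfile_one]; exact outerProfile_mono (by linarith) h1.le
    unfold profile
    nlinarith [mul_le_mul_of_nonneg_left (show outerProfile s - s ≤ 6 / 5 - s by linarith) hc0]

/-- Every `w < 10/3` is a value of the profile. [folklore] -/
theorem exists_profile_eq {w : ℝ} (hw : w < 10 / 3) : ∃ s, profile s = w := by
  -- a point below
  set a : ℝ := min w 0 - 1 with ha
  have ha1 : a ≤ 2 / 3 := by
    have : min w 0 ≤ 0 := min_le_right _ _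
    linarith
  have hpa : profile a ≤ w := by
    rw [profile_of_le ha1]
    have : min w 0 ≤ w := min_le_left _ _
    linarith
  -- a point above
  obtain ⟨b, hab, hwb⟩ : ∃ b, a ≤ b ∧ w ≤ profile b := by
    have hgap : 0 < 10 / 3 - w := by linarith
    set b : ℝ := max 1 (32 / 3 / (10 / 3 - w)) with hb
    have hb1 : 1 ≤ b := le_max_left _ _
    have hb2 : 32 / 3 / (10 / 3 - w) ≤ b := le_max_right _ _
    refine ⟨b, by linarith, ?_⟩
    rw [profile_of_one_le hb1, outerProfile_eq (by linarith)]
    have h3 : 0 < 3 * b + 2 := by linarith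
    have : 32 / 3 / (3 * b + 2) ≤ 10 / 3 - w := by
      rw [div_le_iff₀ h3]
      have := (div_le_iff₀ hgap).1 hb2
      nlinarith
    linarith
  have := intermediate_value_Icc hab continuous_profile.continuousOn
  exact let ⟨s, _, hs⟩ := this ⟨hpa, hwb⟩; ⟨s, hs⟩

/-- The range of the profile is `(-∞, 10/3)`. [folklore] -/
theorem range_profile : range profile = Iio (10 / 3) :=
  Set.ext fun _ => ⟨fun ⟨s, hs⟩ => hs ▸ profile_lt s, fun hw => exists_profile_eq hw⟩

/-! ### The inverse profile -/

/-- The inverse `q` of the profile `p` (on `(-∞, 10/3)`, the range of `p`). [folklore] -/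
def profileInv : ℝ → ℝ := invFun profile

/-- `q ∘ p = id`. [folklore] -/
theorem profileInv_profile (s : ℝ) : profileInv (profile s) = s :=
  leftInverse_invFun injective_profile s

/-- `p ∘ q = id` on `(-∞, 10/3)`. [folklore] -/
theorem profile_profileInv {w : ℝ} (hw : w < 10 / 3) : profile (profileInv w) = w :=
  invFun_eq (exists_profile_eq hw)

/-- The inverse profile is the identity on `(-∞, 2/3]`. [folklore] -/
theorem profileInv_of_le {w : ℝ} (hw : w ≤ 2 / 3) : profileInv w = w := by
  conv_lhs => rw [← profile_of_le hw]
  exact profileInv_profile w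

/-- Near a point `w < 2/3` the inverse profile is the identity. [folklore] -/
theorem profileInv_eventuallyEq_id {w : ℝ} (hw : w < 2 / 3) : profileInv =ᶠ[𝓝 w] id :=
  (eventually_lt_nhds hw).mono fun _ ht => profileInv_of_le ht.le

/-- The inverse profile is positive on `(0, 10/3)`. [folklore] -/
theorem profileInv_pos {w : ℝ} (hw0 : 0 < w) (hw : w < 10 / 3) : 0 < profileInv w := by
  by_contra h
  push Not at h
  have := strictMono_profile.monotone h
  rw [profile_profileInv hw, profile_zero] at this
  linarith


/-- The inverse profile is smooth on the range of the profile: near a value `w < 2/3` it is the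
identity, elsewhere it is a left inverse of the étale map `p` (`p' > 0`,
`Literature.Topology.FourManifolds.contDiffAt_leftInverse_of_hasDerivAt`). [folklore] -/
theorem contDiffAt_profileInv {w : ℝ} (hw : w < 10 / 3) : ContDiffAt ℝ ∞ profileInv w := by
  by_cases hw' : w < 2 / 3
  · exact contDiffAt_id.congr_of_eventuallyEq (profileInv_eventuallyEq_id hw')
  push Not at hw'
  set s := profileInv w with hs
  have hsw : profile s = w := profile_profileInv hw
  have hs23 : 2 / 3 ≤ s := by
    by_contra h
    push Not at h
    have := profile_of_le h.le
    rw [hsw] at this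
    linarith
  have h3 : 3 * s + 2 ≠ 0 := by linarith
  have hd : HasDerivAt profile (deriv profile s) s :=
    (hasDerivAt_profile h3).differentiableAt.hasDerivAt
  rw [← hsw]
  exact contDiffAt_leftInverse_of_hasDerivAt (contDiffAt_profile s) hd (deriv_profile_pos s).ne'
    (by simp) profileInv_profile

/-- The inverse profile is continuous on `(-∞, 10/3)`. [folklore] -/
theorem continuousAt_profileInv {w : ℝ} (hw : w < 10 / 3) : ContinuousAt profileInv w :=
  (contDiffAt_profileInv hw).continuousAt

/-! ### The radial diffeomorphism `Literature.radialMap profile` onto the ball of radius `10/3` -/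

section Radial

variable {E : Type*} [NormedAddCommGroup E] [InnerProductSpace ℝ E]

/-- The radial map of the profile is the identity on the open ball of radius `2/3` (the profile
being the identity there, `Literature.Topology.FourManifolds.radialMap_eq_smul_of_norm_lt`). [folklore] -/
theorem radialMap_profile_eq_self {x : E} (hx : ‖x‖ < 2 / 3) : radialMap profile x = x := by
  rw [radialMap_eq_smul_of_norm_lt profile (c := 1) (r := 2 / 3)
    (fun t _ ht => by rw [one_mul]; exact profile_of_le ht.le) hx, one_smul]

/-- `‖B x‖ = p(‖x‖)`: the radial map multiplies norms by the profile. [folklore] -/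
theorem norm_radialMap_profile (x : E) : ‖radialMap profile x‖ = profile ‖x‖ := by
  rcases eq_or_ne x 0 with rfl | hx
  · rw [radialMap_zero, norm_zero, profile_zero]
  · rw [norm_radialMap profile hx, abs_of_nonneg (profile_nonneg (norm_nonneg x))]

/-- The radial map takes values in the ball of radius `10/3`. [folklore] -/
theorem norm_radialMap_profile_lt (x : E) : ‖radialMap profile x‖ < 10 / 3 := by
  rw [norm_radialMap_profile]; exact profile_lt _

/-- Only the origin is mapped to the origin by the radial map. [folklore] -/
theorem radialMap_profile_eq_zero_iff {x : E} : radialMap profile x = 0 ↔ x = 0 := by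
  refine ⟨fun h => ?_, fun h => by rw [h, radialMap_zero]⟩
  have h1 : profile ‖x‖ = 0 := by rw [← norm_radialMap_profile, h, norm_zero]
  by_contra hx
  exact (profile_pos (norm_pos_iff.2 hx)).ne' h1

/-- The radial map is smooth (near the origin it is the identity; elsewhere
`Literature.Topology.FourManifolds.contDiffAt_radialMap`). [folklore] -/
theorem contDiff_radialMap_profile : ContDiff ℝ ∞ (radialMap profile : E → E) := by
  refine contDiff_iff_contDiffAt.2 fun x => ?_
  by_cases hx : ‖x‖ < 2 / 3
  · have h : (radialMap profile : E → E) =ᶠ[𝓝 x] id := by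
      have : Metric.ball (0 : E) (2 / 3) ∈ 𝓝 x := Metric.isOpen_ball.mem_nhds (by simpa using hx)
      exact Filter.mem_of_superset this fun y hy =>
        radialMap_profile_eq_self (by simpa using hy)
    exact contDiffAt_id.congr_of_eventuallyEq h
  · have hx0 : x ≠ 0 := by
      rintro rfl
      exact hx (by rw [norm_zero]; norm_num)
    exact contDiffAt_radialMap hx0 (contDiffAt_profile _)

/-- The radial map of the inverse profile is the identity on the open ball of radius `2/3`.
[folklore] -/
theorem radialMap_profileInv_eq_self {y : E} (hy : ‖y‖ < 2 / 3) : radialMap profileInv y = y := by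
  rw [radialMap_eq_smul_of_norm_lt profileInv (c := 1) (r := 2 / 3)
    (fun t _ ht => by rw [one_mul]; exact profileInv_of_le ht.le) hy, one_smul]

/-- `B⁻¹ ∘ B = id` for `B = radialMap profile`, `B⁻¹ = radialMap profileInv`. [folklore] -/
theorem radialMap_profileInv_radialMap_profile (x : E) :
    radialMap profileInv (radialMap profile x) = x := by
  rcases eq_or_ne x 0 with rfl | hx
  · rw [radialMap_zero, radialMap_zero]
  · rw [radialMap_radialMap profileInv profile hx (profile_pos (norm_pos_iff.2 hx)),
      profileInv_profile, mul_inv_cancel₀ (norm_ne_zero_iff.2 hx), one_smul]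

/-- `B ∘ B⁻¹ = id` on the ball of radius `10/3`. [folklore] -/
theorem radialMap_profile_radialMap_profileInv {y : E} (hy : ‖y‖ < 10 / 3) :
    radialMap profile (radialMap profileInv y) = y := by
  rcases eq_or_ne y 0 with rfl | hy0
  · rw [radialMap_zero, radialMap_zero]
  · rw [radialMap_radialMap profile profileInv hy0 (profileInv_pos (norm_pos_iff.2 hy0) hy),
      profile_profileInv hy, mul_inv_cancel₀ (norm_ne_zero_iff.2 hy0), one_smul]

/-- The inverse radial map is smooth at every point of the ball of radius `10/3`. [folklore] -/
theorem contDiffAt_radialMap_profileInv {y : E} (hy : ‖y‖ < 10 / 3) :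
    ContDiffAt ℝ ∞ (radialMap profileInv : E → E) y := by
  by_cases hy' : ‖y‖ < 2 / 3
  · have h : (radialMap profileInv : E → E) =ᶠ[𝓝 y] id := by
      have : Metric.ball (0 : E) (2 / 3) ∈ 𝓝 y := Metric.isOpen_ball.mem_nhds (by simpa using hy')
      exact Filter.mem_of_superset this fun z hz =>
        radialMap_profileInv_eq_self (by simpa using hz)
    exact contDiffAt_id.congr_of_eventuallyEq h
  · have hy0 : y ≠ 0 := by
      rintro rfl
      exact hy' (by rw [norm_zero]; norm_num)
    exact contDiffAt_radialMap hy0 (contDiffAt_profileInv hy)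

/-- The inverse radial map is smooth on the ball of radius `10/3`. [folklore] -/
theorem contDiffOn_radialMap_profileInv :
    ContDiffOn ℝ ∞ (radialMap profileInv : E → E) (Metric.ball 0 (10 / 3)) :=
  fun _ hy => (contDiffAt_radialMap_profileInv (by simpa using hy)).contDiffWithinAt

end Radial

/-! ### The gluing relation in radial coordinates -/

section RadialRel

variable {E : Type*} [NormedAddCommGroup E] [InnerProductSpace ℝ E]

/-- `p(1) = 6/5 = 4 / p(∞)`. [folklore] -/
theorem profile_one : profile 1 = 6 / 5 := by
  rw [profile_of_one_le le_rfl, outerProfile_one]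

/-- The functional equation of the profile: `p(s) p(s/(s-1)) = 4` for `1 < s`. [folklore] -/
theorem profile_mul_profile {s : ℝ} (hs : 1 < s) : profile s * profile (s / (s - 1)) = 4 := by
  have hs' : 1 < s / (s - 1) := by
    rw [lt_div_iff₀ (by linarith)]; linarith
  rw [profile_of_one_le hs.le, profile_of_one_le hs'.le]
  exact outerProfile_mul_outerProfile hs

/-- **The gluing relation in radial coordinates.** For `X, Y` in a real inner product space,
`X ≠ 0` and `(4/‖B X‖²) B X = B Y` (with `B = radialMap profile`) hold iff `1 < ‖X‖` and
`Y = (‖X‖ - 1)⁻¹ X`. [folklore] -/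
theorem radial_rel_iff {X Y : E} :
    (X ≠ 0 ∧ (4 / ‖radialMap profile X‖ ^ 2) • radialMap profile X = radialMap profile Y) ↔
      (1 < ‖X‖ ∧ Y = (‖X‖ - 1)⁻¹ • X) := by
  constructor
  · rintro ⟨hX, h⟩
    have hs0 : 0 < ‖X‖ := norm_pos_iff.2 hX
    have hps : 0 < profile ‖X‖ := profile_pos hs0
    -- norms: 4 / p(‖X‖) = p(‖Y‖)
    have hnorm : 4 / profile ‖X‖ = profile ‖Y‖ := by
      have h1 := congrArg norm h
      rw [norm_smul, norm_radialMap_profile, norm_radialMap_profile,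
        Real.norm_of_nonneg (by positivity)] at h1
      rw [← h1]
      field_simp
    -- hence 1 < ‖X‖
    have h1s : 1 < ‖X‖ := by
      have hlt : profile ‖Y‖ < 10 / 3 := profile_lt _
      rw [← hnorm, div_lt_iff₀ hps] at hlt
      have : profile 1 < profile ‖X‖ := by rw [profile_one]; linarith
      exact strictMono_profile.lt_iff_lt.1 this
    have hs1 : (0 : ℝ) < ‖X‖ - 1 := by linarith
    refine ⟨h1s, ?_⟩
    -- ‖Y‖ = ‖X‖ / (‖X‖ - 1)
    have hY : ‖Y‖ = ‖X‖ / (‖X‖ - 1) := by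
      apply injective_profile
      have h2 := profile_mul_profile h1s
      rw [← hnorm, div_eq_iff hps.ne']
      linarith
    have hY0 : 0 < ‖Y‖ := by rw [hY]; positivity
    have hpY : 0 < profile ‖Y‖ := profile_pos hY0
    have hcY : profile ‖Y‖ * ‖Y‖⁻¹ ≠ 0 := by positivity
    -- direction: `Y = c • X`
    rw [norm_radialMap_profile] at h
    simp only [radialMap, smul_smul] at h
    -- h : (4 / p‖X‖² * (p‖X‖ * ‖X‖⁻¹)) • X = (p‖Y‖ * ‖Y‖⁻¹) • Y
    have hdir : Y = ((profile ‖Y‖ * ‖Y‖⁻¹)⁻¹ *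
        (4 / profile ‖X‖ ^ 2 * (profile ‖X‖ * ‖X‖⁻¹))) • X := by
      rw [mul_smul, h, inv_smul_smul₀ hcY]
    -- the coefficient is `(‖X‖ - 1)⁻¹`
    have hcoef : (profile ‖Y‖ * ‖Y‖⁻¹)⁻¹ * (4 / profile ‖X‖ ^ 2 * (profile ‖X‖ * ‖X‖⁻¹)) =
        (‖X‖ - 1)⁻¹ := by
      rw [← hnorm, hY]
      have hps' : profile ‖X‖ ≠ 0 := hps.ne'
      have hs0' : ‖X‖ ≠ 0 := hs0.ne'
      have hs1' : ‖X‖ - 1 ≠ 0 := hs1.ne'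
      field_simp
    rw [hdir, hcoef]
  · rintro ⟨h1s, hY⟩
    have hs0 : 0 < ‖X‖ := by linarith
    have hX : X ≠ 0 := norm_pos_iff.1 hs0
    refine ⟨hX, ?_⟩
    have hs1 : 0 < ‖X‖ - 1 := by linarith
    have hnY : ‖Y‖ = ‖X‖ / (‖X‖ - 1) := by
      rw [hY, norm_smul, Real.norm_of_nonneg (inv_nonneg.2 hs1.le)]
      field_simp
    have hps : 0 < profile ‖X‖ := profile_pos hs0
    have h2 := profile_mul_profile h1s
    have e3 : profile (‖X‖ / (‖X‖ - 1)) = 4 / profile ‖X‖ := by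
      rw [eq_div_iff hps.ne']; linarith
    rw [norm_radialMap_profile]
    simp only [radialMap, smul_smul]
    rw [hnY, hY, smul_smul]
    congr 1
    rw [e3]
    have hps' : profile ‖X‖ ≠ 0 := hps.ne'
    have hs0' : ‖X‖ ≠ 0 := hs0.ne'
    have hs1' : ‖X‖ - 1 ≠ 0 := hs1.ne'
    field_simp

/-- The relation `1 < ‖X‖ ∧ Y = (‖X‖ - 1)⁻¹ X` in polar form: `X = t⁻¹ u`, `Y = (1 - t)⁻¹ u` for a
unit vector `u` and `t ∈ (0, 1)`. [folklore] -/
theorem one_lt_norm_and_eq_iff {X Y : E} :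
    (1 < ‖X‖ ∧ Y = (‖X‖ - 1)⁻¹ • X) ↔
      ∃ (u : E) (t : ℝ), ‖u‖ = 1 ∧ t ∈ Ioo (0 : ℝ) 1 ∧ X = t⁻¹ • u ∧ Y = (1 - t)⁻¹ • u := by
  constructor
  · rintro ⟨h1, hY⟩
    have hs0 : 0 < ‖X‖ := by linarith
    refine ⟨‖X‖⁻¹ • X, ‖X‖⁻¹, ?_, ⟨by positivity, inv_lt_one_of_one_lt₀ h1⟩, ?_, ?_⟩
    · rw [norm_smul, norm_inv, norm_norm, inv_mul_cancel₀ hs0.ne']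
    · rw [smul_smul, inv_inv, mul_inv_cancel₀ hs0.ne', one_smul]
    · rw [hY, smul_smul]
      congr 1
      have hs1 : ‖X‖ - 1 ≠ 0 := by linarith
      have hs0' : ‖X‖ ≠ 0 := hs0.ne'
      field_simp
  · rintro ⟨u, t, hu, ⟨ht0, ht1⟩, hX, hY⟩
    have hnX : ‖X‖ = t⁻¹ := by
      rw [hX, norm_smul, norm_inv, Real.norm_of_nonneg ht0.le, hu, mul_one]
    refine ⟨by rw [hnX]; exact one_lt_inv_iff₀.2 ⟨ht0, ht1⟩, ?_⟩
    rw [hY, hnX, hX, smul_smul]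
    congr 1
    have ht1' : 1 - t ≠ 0 := by linarith
    have ht0' : t ≠ 0 := ht0.ne'
    field_simp

end RadialRel

/-! ### The model: `Sⁿ` is an open gluing of two punctured spheres (Kervaire–Milnor's relation) -/

section SphereModel

open Metric

variable {V : Type*} [NormedAddCommGroup V] [InnerProductSpace ℝ V] {n : ℕ}
  [Fact (finrank ℝ V = n + 1)]

/-- `R(-v) = v` for the reflection of the sphere in `vᗮ`. [folklore] -/
theorem poleReflectionSphere_neg_pole (v : sphere (0 : V) 1) :
    poleReflectionSphere (n := n) v (-v) = v := by
  have h := poleReflectionSphere_poleReflectionSphere (n := n) v v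
  rwa [poleReflectionSphere_pole] at h

/-- Points other than `-v` are not reflected onto the pole `v`. [folklore] -/
theorem poleReflectionSphere_ne_pole {v a : sphere (0 : V) 1} (ha : a ≠ -v) :
    poleReflectionSphere (n := n) v a ≠ v := by
  intro h
  apply ha
  have h2 := poleReflectionSphere_poleReflectionSphere (n := n) v a
  rw [h, poleReflectionSphere_pole] at h2
  exact h2.symm

/-- `σᵥ⁻¹` is injective. [folklore] -/
theorem stereographic'_symm_injective (v : sphere (0 : V) 1) :
    Injective (stereographic' n v).symm := fun x y h => by
  simpa [stereographic'_stereographic'_symm] using congrArg (stereographic' n v) h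

/-- `R (σᵥ⁻¹ z) = σᵥ⁻¹ ((4/‖z‖²) z)` on the sphere, `z ≠ 0`: the `Subtype` form of
`Literature.Topology.FourManifolds.poleReflection_stereographic'_symm`. [folklore] -/
theorem poleReflectionSphere_stereographic'_symm (v : sphere (0 : V) 1)
    {z : EuclideanSpace ℝ (Fin n)} (hz : z ≠ 0) :
    poleReflectionSphere (n := n) v ((stereographic' n v).symm z) =
      (stereographic' n v).symm ((4 / ‖z‖ ^ 2) • z) :=
  Subtype.ext (by
    simp only [LinearIsometryEquiv.coe_sphereDiffeomorph_apply]
    exact poleReflection_stereographic'_symm v hz)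

/-- **Disc points in reflected coordinates**: for `a ≠ -v` and `w ≠ 0`,
`a = σᵥ⁻¹ w ↔ σᵥ (R a) = (4/‖w‖²) w` (the reflection acts as the inversion in the sphere of
radius `2`, `poleReflectionSphere_stereographic'_symm`). [folklore] -/
theorem eq_stereographic'_symm_iff {v a : sphere (0 : V) 1} (ha : a ≠ -v)
    {w : EuclideanSpace ℝ (Fin n)} (hw : w ≠ 0) :
    a = (stereographic' n v).symm w ↔
      stereographic' n v (poleReflectionSphere (n := n) v a) = (4 / ‖w‖ ^ 2) • w := by
  have hRa : poleReflectionSphere (n := n) v a ≠ v := poleReflectionSphere_ne_pole ha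
  constructor
  · rintro rfl
    rw [poleReflectionSphere_stereographic'_symm v hw, stereographic'_stereographic'_symm]
  · intro h
    have h1 : poleReflectionSphere (n := n) v a =
        (stereographic' n v).symm ((4 / ‖w‖ ^ 2) • w) := by
      rw [← h, stereographic'_symm_apply_of_ne v hRa]
    rw [← poleReflectionSphere_stereographic'_symm v hw] at h1
    have h2 := congrArg (poleReflectionSphere (n := n) v) h1
    rwa [poleReflectionSphere_poleReflectionSphere, poleReflectionSphere_poleReflectionSphere] at h2

/-- The open cap `σᵥ⁻¹(B(0, 10/3)) = {y | ⟪y, v⟫ < 8/17}`, the common shape of the ranges of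
the two gluing embeddings of the model. [folklore] -/
def cap (v : sphere (0 : V) 1) : TopologicalSpace.Opens (sphere (0 : V) 1) :=
  ⟨(stereographic' n v).source ∩ stereographic' n v ⁻¹' ball 0 (10 / 3),
    (stereographic' n v).isOpen_inter_preimage isOpen_ball⟩

/-- Membership in the cap: `y ≠ v` and `‖σᵥ y‖ < 10/3`. [folklore] -/
theorem mem_cap {v y : sphere (0 : V) 1} :
    y ∈ cap (n := n) v ↔ y ≠ v ∧ ‖stereographic' n v y‖ < 10 / 3 := by
  simp [cap, stereographic'_source, ← SetLike.mem_coe]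

/-- The cap in terms of heights: `y ∈ cap (n := n) v ↔ ⟪y, v⟫ < 8/17`. [folklore] -/
theorem mem_cap_iff_inner {v y : sphere (0 : V) 1} :
    y ∈ cap (n := n) v ↔ ⟪(y : V), (v : V)⟫ < 8 / 17 := by
  have hv1 : ⟪(v : V), (v : V)⟫ = 1 := by
    rw [real_inner_self_eq_norm_sq, norm_eq_of_mem_sphere v]; norm_num
  constructor
  · intro hy
    obtain ⟨hyv, hyn⟩ := mem_cap.1 hy
    have hy' : y = (stereographic' n v).symm (stereographic' n v y) :=
      (stereographic'_symm_apply_of_ne v hyv).symm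
    rw [hy', real_inner_stereographic'_symm_pole]
    have hq : ‖stereographic' n v y‖ ^ 2 < 100 / 9 := by
      nlinarith [norm_nonneg (stereographic' n v y)]
    rw [div_lt_div_iff₀ (by positivity) (by norm_num)]
    nlinarith
  · intro h
    have hyv : y ≠ v := by
      rintro rfl
      rw [hv1] at h
      norm_num at h
    refine mem_cap.2 ⟨hyv, ?_⟩
    have hy' : y = (stereographic' n v).symm (stereographic' n v y) :=
      (stereographic'_symm_apply_of_ne v hyv).symm
    rw [hy', real_inner_stereographic'_symm_pole,
      div_lt_div_iff₀ (by positivity) (by norm_num)] at h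
    have hq : ‖stereographic' n v y‖ ^ 2 < (10 / 3) ^ 2 := by nlinarith
    exact lt_of_pow_lt_pow_left₀ 2 (by norm_num) hq

/-- The cap and its reflection cover the sphere. [folklore] -/
theorem mem_cap_or_poleReflectionSphere_mem_cap (v y : sphere (0 : V) 1) :
    y ∈ cap (n := n) v ∨ poleReflectionSphere (n := n) v y ∈ cap (n := n) v := by
  by_cases h : ⟪(y : V), (v : V)⟫ < 8 / 17
  · exact Or.inl (mem_cap_iff_inner.2 h)
  · right
    rw [mem_cap_iff_inner, LinearIsometryEquiv.coe_sphereDiffeomorph_apply,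
      inner_poleReflection_pole]
    linarith

/-- The model map `Θ_T : a ↦ σᵥ⁻¹ (B (T (σᵥ (R a) / 4)))` for a continuous linear automorphism
`T` of `ℝⁿ` (`B = radialMap profile`). [folklore] -/
def modelFun (v : sphere (0 : V) 1) (T : EuclideanSpace ℝ (Fin n) ≃L[ℝ] EuclideanSpace ℝ (Fin n))
    (a : sphere (0 : V) 1) : sphere (0 : V) 1 :=
  (stereographic' n v).symm
    (radialMap profile (T ((4 : ℝ)⁻¹ • stereographic' n v (poleReflectionSphere (n := n) v a))))

/-- The inverse of the model map, `y ↦ R (σᵥ⁻¹ (4 T⁻¹ (B⁻¹ (σᵥ y))))`. [folklore] -/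
def modelInv (v : sphere (0 : V) 1) (T : EuclideanSpace ℝ (Fin n) ≃L[ℝ] EuclideanSpace ℝ (Fin n))
    (y : sphere (0 : V) 1) : sphere (0 : V) 1 :=
  poleReflectionSphere (n := n) v
    ((stereographic' n v).symm ((4 : ℝ) • T.symm (radialMap profileInv (stereographic' n v y))))

/-- The model map takes values in the cap. [folklore] -/
theorem modelFun_mem (v : sphere (0 : V) 1)
    (T : EuclideanSpace ℝ (Fin n) ≃L[ℝ] EuclideanSpace ℝ (Fin n)) (a : sphere (0 : V) 1) :
    modelFun v T a ∈ cap (n := n) v := by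
  refine mem_cap.2 ⟨stereographic'_symm_ne v _, ?_⟩
  rw [modelFun, stereographic'_stereographic'_symm]
  exact norm_radialMap_profile_lt _

/-- The inverse model map avoids `-v`. [folklore] -/
theorem modelInv_ne (v : sphere (0 : V) 1)
    (T : EuclideanSpace ℝ (Fin n) ≃L[ℝ] EuclideanSpace ℝ (Fin n)) (y : sphere (0 : V) 1) :
    modelInv v T y ≠ -v := by
  intro h
  have h1 := congrArg (poleReflectionSphere (n := n) v) h
  rw [modelInv, poleReflectionSphere_poleReflectionSphere, poleReflectionSphere_neg_pole] at h1
  exact stereographic'_symm_ne v _ h1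

/-- `Θ⁻¹ ∘ Θ = id` off `-v`. [folklore] -/
theorem modelInv_modelFun (v : sphere (0 : V) 1)
    (T : EuclideanSpace ℝ (Fin n) ≃L[ℝ] EuclideanSpace ℝ (Fin n)) {a : sphere (0 : V) 1}
    (ha : a ≠ -v) : modelInv v T (modelFun v T a) = a := by
  have hRa : poleReflectionSphere (n := n) v a ≠ v := poleReflectionSphere_ne_pole ha
  simp only [modelInv, modelFun, stereographic'_stereographic'_symm,
    radialMap_profileInv_radialMap_profile, ContinuousLinearEquiv.symm_apply_apply]
  rw [smul_inv_smul₀ (by norm_num : (4 : ℝ) ≠ 0), stereographic'_symm_apply_of_ne v hRa,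
    poleReflectionSphere_poleReflectionSphere]

/-- `Θ ∘ Θ⁻¹ = id` on the cap. [folklore] -/
theorem modelFun_modelInv (v : sphere (0 : V) 1)
    (T : EuclideanSpace ℝ (Fin n) ≃L[ℝ] EuclideanSpace ℝ (Fin n)) {y : sphere (0 : V) 1}
    (hy : y ∈ cap (n := n) v) : modelFun v T (modelInv v T y) = y := by
  obtain ⟨hyv, hyn⟩ := mem_cap.1 hy
  simp only [modelInv, modelFun, poleReflectionSphere_poleReflectionSphere,
    stereographic'_stereographic'_symm]
  rw [inv_smul_smul₀ (by norm_num : (4 : ℝ) ≠ 0), ContinuousLinearEquiv.apply_symm_apply,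
    radialMap_profile_radialMap_profileInv hyn, stereographic'_symm_apply_of_ne v hyv]

/-- The model map is smooth on any open set avoiding `-v` (composite of the reflection, the
stereographic chart off the pole, a scaling, a linear map, the radial map and the inverse
stereographic projection). [folklore] -/
theorem contMDiff_modelFun_comp (v : sphere (0 : V) 1)
    (T : EuclideanSpace ℝ (Fin n) ≃L[ℝ] EuclideanSpace ℝ (Fin n))
    (A : TopologicalSpace.Opens (sphere (0 : V) 1)) (hA : ∀ a, a ∈ A → a ≠ -v) :
    ContMDiff (𝓡 n) (𝓡 n) ∞ (fun a : A => modelFun v T a) := by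
  have h1 : ContMDiff (𝓡 n) (𝓡 n) ∞ (fun a : A => poleReflectionSphere (n := n) v a) :=
    (poleReflectionSphere (n := n) v).contMDiff.comp contMDiff_subtype_val
  have h2 : ContMDiff (𝓡 n) (𝓡 n) ∞
      (fun a : A => stereographic' n v (poleReflectionSphere (n := n) v a)) :=
    (contMDiffOn_stereographic' v).comp_contMDiff h1 fun a =>
      poleReflectionSphere_ne_pole (hA a a.2)
  have h3 : ContMDiff (𝓡 n) (𝓡 n) ∞
      (fun a : A => T ((4 : ℝ)⁻¹ • stereographic' n v (poleReflectionSphere (n := n) v a))) :=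
    T.contDiff.contMDiff.comp ((contDiff_const_smul (4 : ℝ)⁻¹).contMDiff.comp h2)
  have h4 : ContMDiff (𝓡 n) (𝓡 n) ∞ (fun a : A =>
      radialMap profile (T ((4 : ℝ)⁻¹ • stereographic' n v (poleReflectionSphere (n := n) v a)))) :=
    (contDiff_radialMap_profile (E := EuclideanSpace ℝ (Fin n))).contMDiff.comp h3
  exact (contMDiff_stereographic'_symm v).comp h4

/-- The inverse model map is smooth on the cap (the inverse radial map being smooth on the ball of
radius `10/3`). [folklore] -/
theorem contMDiff_modelInv_comp (v : sphere (0 : V) 1)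
    (T : EuclideanSpace ℝ (Fin n) ≃L[ℝ] EuclideanSpace ℝ (Fin n)) :
    ContMDiff (𝓡 n) (𝓡 n) ∞ (fun y : cap (n := n) v => modelInv v T y) := by
  have g1 : ContMDiff (𝓡 n) (𝓡 n) ∞ (fun y : cap (n := n) v => stereographic' n v y) :=
    (contMDiffOn_stereographic' v).comp_contMDiff contMDiff_subtype_val fun y => (mem_cap.1 y.2).1
  have g2 : ContMDiff (𝓡 n) (𝓡 n) ∞
      (fun y : cap (n := n) v => radialMap profileInv (stereographic' n v y)) :=
    (contDiffOn_radialMap_profileInv (E := EuclideanSpace ℝ (Fin n))).contMDiffOn.comp_contMDiff g1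
      fun y => by simpa using (mem_cap.1 y.2).2
  have g3 : ContMDiff (𝓡 n) (𝓡 n) ∞
      (fun y : cap (n := n) v => (4 : ℝ) • T.symm (radialMap profileInv (stereographic' n v y))) :=
    (contDiff_const_smul (4 : ℝ)).contMDiff.comp (T.symm.contDiff.contMDiff.comp g2)
  have g4 : ContMDiff (𝓡 n) (𝓡 n) ∞ (fun y : cap (n := n) v =>
      (stereographic' n v).symm ((4 : ℝ) • T.symm (radialMap profileInv (stereographic' n v y)))) :=
    (contMDiff_stereographic'_symm v).comp g3
  exact (poleReflectionSphere (n := n) v).contMDiff.comp g4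

/-- **The model diffeomorphism** `Θ_T : Sⁿ ∖ {-v} ≅ cap (n := n) v` (for any open `A` with carrier
`{-v}ᶜ`). [folklore] -/
def modelDiffeo (v : sphere (0 : V) 1) (T : EuclideanSpace ℝ (Fin n) ≃L[ℝ] EuclideanSpace ℝ (Fin n))
    (A : TopologicalSpace.Opens (sphere (0 : V) 1)) (hA : ∀ a, a ∈ A ↔ a ≠ -v) :
    A ≃ₘ⟮𝓡 n, 𝓡 n⟯ (cap (n := n) v) where
  toFun a := ⟨modelFun v T a, modelFun_mem v T a⟩
  invFun y := ⟨modelInv v T y, (hA _).2 (modelInv_ne v T y)⟩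
  left_inv a := Subtype.ext (modelInv_modelFun v T ((hA a).1 a.2))
  right_inv y := Subtype.ext (modelFun_modelInv v T y.2)
  contMDiff_toFun :=
    (ContMDiff.subtypeVal_comp_iff _ _).mp (contMDiff_modelFun_comp v T A fun a ha => (hA a).1 ha)
  contMDiff_invFun := (ContMDiff.subtypeVal_comp_iff _ _).mp (contMDiff_modelInv_comp v T)

/-- The model diffeomorphism acts as the model map. [folklore] -/
@[simp] theorem coe_modelDiffeo_apply (v : sphere (0 : V) 1)
    (T : EuclideanSpace ℝ (Fin n) ≃L[ℝ] EuclideanSpace ℝ (Fin n))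
    (A : TopologicalSpace.Opens (sphere (0 : V) 1)) (hA : ∀ a, a ∈ A ↔ a ≠ -v) (a : A) :
    ((modelDiffeo v T A hA a : cap (n := n) v) : sphere (0 : V) 1) = modelFun v T a := rfl

/-- **The relation of the model in terms of the discs.** For `a, b ≠ -v`, the reflected model
point `R (Θ₁ a)` equals `Θ₂ b` (with `Θ₁ = Θ_{id}` and `Θ₂ = Θ_{L⁻¹}`) iff
`a = σᵥ⁻¹ (t u)` and `b = σᵥ⁻¹ (L ((1 - t) u))` for a unit vector `u` and `t ∈ (0, 1)`.
[cite: KervaireMilnor1963, §2, Lemma 2.1 (p. 505)] -/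
theorem poleReflectionSphere_modelFun_eq_iff (v : sphere (0 : V) 1)
    (L : EuclideanSpace ℝ (Fin n) ≃ₗᵢ[ℝ] EuclideanSpace ℝ (Fin n)) {a b : sphere (0 : V) 1}
    (ha : a ≠ -v) (hb : b ≠ -v) :
    poleReflectionSphere (n := n) v
          (modelFun v (ContinuousLinearEquiv.refl ℝ (EuclideanSpace ℝ (Fin n))) a) =
        modelFun v L.symm.toContinuousLinearEquiv b ↔
      ∃ (u : EuclideanSpace ℝ (Fin n)) (t : ℝ), ‖u‖ = 1 ∧ t ∈ Ioo (0 : ℝ) 1 ∧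
        a = (stereographic' n v).symm (t • u) ∧
        b = (stereographic' n v).symm (L ((1 - t) • u)) := by
  set σ := stereographic' n v with hσ
  set X : EuclideanSpace ℝ (Fin n) := (4 : ℝ)⁻¹ • σ (poleReflectionSphere (n := n) v a) with hX
  set Y : EuclideanSpace ℝ (Fin n) :=
    L.symm.toContinuousLinearEquiv ((4 : ℝ)⁻¹ • σ (poleReflectionSphere (n := n) v b)) with hY
  have h4 : (4 : ℝ) ≠ 0 := by norm_num
  have hX4 : σ (poleReflectionSphere (n := n) v a) = (4 : ℝ) • X := by
    rw [hX, smul_inv_smul₀ h4]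
  have hY4 : σ (poleReflectionSphere (n := n) v b) = (4 : ℝ) • L Y := by
    rw [hY, LinearIsometryEquiv.coe_toContinuousLinearEquiv, L.apply_symm_apply, smul_inv_smul₀ h4]
  -- Step 1: the equation in terms of `X`, `Y`
  have step1 : poleReflectionSphere (n := n) v
        (modelFun v (ContinuousLinearEquiv.refl ℝ (EuclideanSpace ℝ (Fin n))) a) =
        modelFun v L.symm.toContinuousLinearEquiv b ↔
      (X ≠ 0 ∧ (4 / ‖radialMap profile X‖ ^ 2) • radialMap profile X = radialMap profile Y) := by
    show poleReflectionSphere (n := n) v (σ.symm (radialMap profile X)) =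
      σ.symm (radialMap profile Y) ↔ _
    by_cases hX0 : X = 0
    · simp only [hX0, radialMap_zero, ne_eq, not_true_eq_false, false_and, iff_false]
      rw [hσ, stereographic'_symm_zero, poleReflectionSphere_neg_pole]
      exact (stereographic'_symm_ne v _).symm
    · have hz : radialMap profile X ≠ 0 := fun h => hX0 (radialMap_profile_eq_zero_iff.1 h)
      rw [poleReflectionSphere_stereographic'_symm v hz]
      simp only [ne_eq, hX0, not_false_eq_true, true_and]
      exact (stereographic'_symm_injective v).eq_iff
  rw [step1, radial_rel_iff, one_lt_norm_and_eq_iff]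
  clear_value X Y
  -- Step 2: polar coordinates versus discs
  refine exists_congr fun u => exists_congr fun t => ?_
  refine ⟨fun ⟨hu, ht, hXe, hYe⟩ => ⟨hu, ht, ?_, ?_⟩, fun ⟨hu, ht, hae, hbe⟩ => ⟨hu, ht, ?_, ?_⟩⟩
  · -- a = σ⁻¹ (t u)
    have htu : t • u ≠ 0 := smul_ne_zero ht.1.ne' (norm_ne_zero_iff.1 (by rw [hu]; norm_num))
    rw [eq_stereographic'_symm_iff ha htu, hX4, hXe, norm_smul, hu, Real.norm_of_nonneg ht.1.le,
      smul_smul, smul_smul]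
    congr 1
    field_simp
  · -- b = σ⁻¹ (L ((1 - t) u))
    have h1t : (1 - t) ≠ 0 := by linarith [ht.2]
    have hw : L ((1 - t) • u) ≠ 0 := by
      rw [ne_eq, ← norm_eq_zero, L.norm_map, norm_smul, hu, mul_one, Real.norm_eq_abs, abs_eq_zero]
      exact h1t
    rw [eq_stereographic'_symm_iff hb hw, hY4, hYe, L.norm_map, norm_smul, hu,
      Real.norm_of_nonneg (by linarith [ht.2] : (0 : ℝ) ≤ 1 - t), map_smul, map_smul, smul_smul,
      smul_smul]
    congr 1
    field_simp
  · -- X = t⁻¹ u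
    have htu : t • u ≠ 0 := smul_ne_zero ht.1.ne' (norm_ne_zero_iff.1 (by rw [hu]; norm_num))
    have h := (eq_stereographic'_symm_iff ha htu).1 hae
    rw [hX4, norm_smul, hu, Real.norm_of_nonneg ht.1.le, smul_smul] at h
    -- h : 4 • X = (4 / (t * 1) ^ 2 * t) • u
    calc X = (4 : ℝ)⁻¹ • ((4 : ℝ) • X) := (inv_smul_smul₀ h4 X).symm
      _ = (4 : ℝ)⁻¹ • ((4 / (t * 1) ^ 2 * t) • u) := by rw [h]
      _ = t⁻¹ • u := by
        rw [smul_smul]; congr 1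
        have := ht.1.ne'
        field_simp
  · -- Y = (1 - t)⁻¹ u
    have h1t : 0 < 1 - t := by linarith [ht.2]
    have hw : L ((1 - t) • u) ≠ 0 := by
      rw [ne_eq, ← norm_eq_zero, L.norm_map, norm_smul, hu, mul_one, Real.norm_eq_abs, abs_eq_zero]
      exact h1t.ne'
    have h := (eq_stereographic'_symm_iff hb hw).1 hbe
    have hc : 4 / ‖L ((1 - t) • u)‖ ^ 2 = 4 / (1 - t) ^ 2 := by
      rw [L.norm_map, norm_smul, hu, mul_one, Real.norm_of_nonneg h1t.le]
    rw [hc] at h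
    have e : (4 : ℝ) • Y = (4 / (1 - t) ^ 2 * (1 - t)) • u :=
      L.injective (by rw [map_smul, ← hY4, h, map_smul, map_smul, smul_smul])
    calc Y = (4 : ℝ)⁻¹ • ((4 : ℝ) • Y) := (inv_smul_smul₀ h4 Y).symm
      _ = (4 : ℝ)⁻¹ • ((4 / (1 - t) ^ 2 * (1 - t)) • u) := by rw [e]
      _ = (1 - t)⁻¹ • u := by
        rw [smul_smul]; congr 1
        have h1t' : 1 - t ≠ 0 := h1t.ne'
        field_simp

/-- **The model gluing: `Sⁿ` is an open gluing of `Sⁿ ∖ {-v}` with itself along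
Kervaire–Milnor's connected-sum relation** for the standard disc `σᵥ⁻¹` (inverse stereographic
projection from the pole `v`) and the disc `σᵥ⁻¹ ∘ L`, `L` any linear isometry of `ℝⁿ`. The
gluing embeddings are `R ∘ Θ_{id}` and `Θ_{L⁻¹}` (`modelDiffeo`), their ranges are the
reflected cap and the cap, which cover the sphere.
[cite: KervaireMilnor1963, §2, Lemma 2.1 (p. 505)] [cite: Kosinski1993, Ch. VI §1] -/
theorem isOpenGluing_sphere (v : sphere (0 : V) 1)
    (L : EuclideanSpace ℝ (Fin n) ≃ₗᵢ[ℝ] EuclideanSpace ℝ (Fin n)) :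
    IsOpenGluing (𝓡 n) (𝓡 n) (𝓡 n) (A := puncture (stereographic' n v).symm)
      (B := puncture ((stereographic' n v).symm ∘ L)) (P := sphere (0 : V) 1)
      (connectedSumRel (stereographic' n v).symm ((stereographic' n v).symm ∘ L)) := by
  have hA : ∀ a, a ∈ puncture (stereographic' n v).symm ↔ a ≠ -v := fun a => by
    rw [mem_puncture, stereographic'_symm_zero]
  have hB : ∀ b, b ∈ puncture ((stereographic' n v).symm ∘ L) ↔ b ≠ -v := fun b => by
    rw [mem_puncture, comp_apply, map_zero, stereographic'_symm_zero]
  set ΘA := modelDiffeo v (ContinuousLinearEquiv.refl ℝ (EuclideanSpace ℝ (Fin n)))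
    (puncture (stereographic' n v).symm) hA with hΘA
  set ΘB := modelDiffeo v L.symm.toContinuousLinearEquiv
    (puncture ((stereographic' n v).symm ∘ L)) hB with hΘB
  set R := poleReflectionSphere (n := n) v with hR
  have hrA : range (Subtype.val ∘ ΘA) = (cap (n := n) v : Set (sphere (0 : V) 1)) := by
    rw [range_comp, (EquivLike.surjective ΘA).range_eq, image_univ, Subtype.range_coe]
  have hrB : range (Subtype.val ∘ ΘB) = (cap (n := n) v : Set (sphere (0 : V) 1)) := by
    rw [range_comp, (EquivLike.surjective ΘB).range_eq, image_univ, Subtype.range_coe]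
  refine ⟨R ∘ (Subtype.val ∘ ΘA), Subtype.val ∘ ΘB, ?_, ?_, ?_, ?_, ?_, fun a b => ?_⟩
  · exact isSmoothEmbedding_diffeomorph_comp_of_range_eq
      ((Manifold.IsSmoothEmbedding.of_opens (cap (n := n) v)).comp_diffeomorph ΘA) R rfl
  · rw [range_comp, hrA]
    exact R.toHomeomorph.isOpenMap _ (cap (n := n) v).isOpen
  · exact (Manifold.IsSmoothEmbedding.of_opens (cap (n := n) v)).comp_diffeomorph ΘB
  · rw [hrB]; exact (cap (n := n) v).isOpen
  · refine eq_univ_of_forall fun y => ?_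
    rw [range_comp, hrA, hrB]
    rcases mem_cap_or_poleReflectionSphere_mem_cap (n := n) v y with h | h
    · exact Or.inr h
    · exact Or.inl ⟨R y, h, poleReflectionSphere_poleReflectionSphere v y⟩
  · simp only [comp_apply, hΘA, hΘB, coe_modelDiffeo_apply, hR]
    rw [poleReflectionSphere_modelFun_eq_iff v L ((hA a).1 a.2) ((hB b).1 b.2)]
    simp only [connectedSumRel, comp_apply, map_smul]

omit [Fact (finrank ℝ V = n + 1)] in
/-- **`Sⁿ = Sⁿ # Sⁿ`**: the unit sphere of an `(n+1)`-dimensional real inner product space is a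
connected sum (`Literature.Topology.FourManifolds.IsConnectedSum`) of itself with itself — along the standard disc `σᵥ⁻¹` at any
pole `v` on both pieces (`isOpenGluing_sphere v (LinearIsometryEquiv.refl ℝ ℝⁿ)`).
[cite: KervaireMilnor1963, §2, Lemma 2.1 (p. 505)] -/
theorem isConnectedSum_sphere_sphere_self [Fact (finrank ℝ V = n + 1)] :
    IsConnectedSum (𝓡 n) (𝓡 n) (𝓡 n) (sphere (0 : V) 1) (sphere (0 : V) 1) (sphere (0 : V) 1) := by
  haveI : Nontrivial V := Module.nontrivial_of_finrank_pos (R := ℝ)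
    (by rw [(Fact.out : finrank ℝ V = n + 1)]; exact Nat.succ_pos n)
  obtain ⟨v₀, hv₀⟩ := (NormedSpace.sphere_nonempty (x := (0 : V)) (r := 1)).2 zero_le_one
  set v : sphere (0 : V) 1 := ⟨v₀, hv₀⟩
  have hσ : Manifold.IsSmoothEmbedding 𝓘(ℝ, EuclideanSpace ℝ (Fin n)) (𝓡 n) ∞
      (stereographic' n v).symm :=
    isSmoothEmbedding_symm_of_target_eq_univ
      (IsManifold.subset_maximalAtlas ⟨v, rfl⟩) (stereographic'_target v)
  refine ⟨(stereographic' n v).symm,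
    (stereographic' n v).symm ∘ LinearIsometryEquiv.refl ℝ (EuclideanSpace ℝ (Fin n)), hσ, ?_,
    isOpenGluing_sphere v (LinearIsometryEquiv.refl ℝ _)⟩
  exact hσ.comp_diffeomorph
    (LinearIsometryEquiv.refl ℝ (EuclideanSpace ℝ (Fin n))).toContinuousLinearEquiv.toDiffeomorph

end SphereModel

end Literature.Topology.FourManifolds.SphereGluing

end
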